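import Summits.QuantumFields.YangMills.Theorems.BalabanUVNodesN07SplitClauseOfRecordShear
import Summits.QuantumFields.YangMills.Theorems.BalabanUVNodesN07SplitClauseBoxesCubeDomains
import Summits.QuantumFields.YangMills.Theorems.BalabanUVNodesN07CubeDomainsAdm22
import HarnessLib

/-!
# N07 [B11] (= [15] = [Balaban1985Variational]) Sect. F, road of record R0′, S6 HEAD: **THE (r2) RECORD DOOR AT THE HEAD's FAMILY AND WINDOW** — n07-w8's sign-free
# record door `localGaugeSplitOn_of_gauge152_recordShear_dominated_adm22_T4` (FILE 8, p627069) at `D := Node00.cubeDomains (F.P K) a M ρ (K − n)`, `Y := π '' □`, with the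
# family's admissibility, the level weights, «the window lies over `Ω_k`», the CANONICAL LEVEL BOXES and their THREE BOX-MEMBERSHIP FACTS all DISCHARGED BY NAME, the widths
# letter in closed form; plus the (r1) orientation `λ_j := −log ĝ_j⁻¹`

Cell `pub-ymgap`, width seat `pub-ymgap-dag-n07-w4` g4 (sub-target S6 = the HEAD), CLAIM-2 ∕ INTENT-2 (cell bus).  `--kind proof --supports stmt-QuantumFields-27364 --as helper`
(K1⁹ per dag-lead KEY MAP v2); count-neutral; def-free.  [15] = [Balaban1985Variational]; [6] = [Balaban1985RegularSpaces]; [4] = [Balaban1984PropagatorsII]; [I.4] =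
[Balaban1984PropagatorsI]; [3] = [Balaban1985Averaging].

THE POINT.  The S6 head's per-datum R0′ assembly (`S6-HEAD-RECIPE.md` § UPDATE g3; `N07LocalLettersSplitCore.DatumGaugeSplitTopStepCore`) reads, at an interior datum, the
torus family `cubeDomains` of the datum's own (1.131) tower and the window `Y = π '' □` (the HB door `N07LocalLettersHBAtCubeDomains.letters10On_HB_cubeDomains_box` is keyed
the same way).  n07-w8's record doors (p625131 §3 ∕ the sign-free p627069) are stated for an ARBITRARY admissible family with DISPLAYED admissibility `Adm22`, level weights, «window over `Ω_k`»,
per-level label boxes `[lo_j, hi_j]`, their widths `D_j` and three box-membership facts.  THIS FILE pins all of those at the head's objects: `Adm22` and «window over `Ω_k`»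
by n07-e 39b (`adm22_cubeDomains`, `inOm_top_cubeDomains_of_mem_box`), the weights canonical (`w m b = (L^{j(b₋)}·L^{−(K−n)})^m`, `IsLevWeight` by `rfl`), the boxes
CANONICAL (`lo_j = sqLo_j − 𝟙`, `hi_j = sqHi_j + 𝟙`, `lo_0 = L(sqLo_1 − 𝟙)`, `hi_0 = L(sqHi_1 + 𝟙) + (L − 1)𝟙`, keyed by four equation binders) with the three facts by FILE 1
(`N07SplitClauseBoxesCubeDomains.levelBoxes_cubeDomains`, collar `L ≤ ρ`) and the widths replaced by their closed-form majorant `d·(M + 4ρ + 3)·L^{(K−n)−j}`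
(`width_levelBox_le`).  What stays DISPLAYED is exactly the analytic content: the extension `H_V` (kernel formula), the (r1)+(r4) row's Landau copy `u♮, U₁` and its
per-level bond letters `v_j` (data) ∕ `a_j` (averages) on the canonical boxes with `d(M + 4ρ + 3)L^{(K−n)−j}·(v_j + a_j) ≤ σ ≤ ½`, S3's gauge `u` of `U` on `π '' □` with
(152) letters `t`, the (159)-splitting `A − H_V X = A₁ + A₂ − A₃` (`X` = the coarse gradient of `λ_j := log ĝ_j⁻¹`) and its three `Letters10On`; conclusion
`LocalGaugeSplitOn (π '' □) η_{K−n} t (t₁ + (t₂ + t_∂) + t₃) U` for every `t_∂ > 2CB₃·(4σ)`.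

WHAT IS PROVED (sorry-free; no definition; axioms standard).  `width_mul_le_of_closedForm` (the widths binder of p625131 ∕ p627069 from the closed-form majorant); ★★★
`localGaugeSplitOn_of_gauge152_recordShear_dominated_cubeDomains_box F N` (statement above with the SIGN-FREE family binder `‖λ_j(y)‖ ≤ ‖log ĝ_j(y)⁻¹‖`; side conditions = the
HB door's: `L·M_h ∣ ρ, a_i, M, sitesPerDir (K−n)`, `R·L·M_h ≤ ρ`, non-wrapping `Set.InjOn π □₀`, plus the collar `L ≤ ρ`); ★★ `localGaugeSplitOn_of_gauge152_recordShear_neg_cubeDomains_box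
F N` (the (r1) orientation `λ_j = −log ĝ_j⁻¹`, n07-w8's LOCATED-SIGN).
HONEST SCOPE.  Count-neutral by-name composition of landed theorems (n07-w8 p625131 ∕ p627069, n07-e 39b `N07CubeDomainsAdm22`, FILE 1 p627154); nothing of [15]∕[6]∕[4]∕[3]
ANALYSIS asserted; the displayed binders above are NOT discharged; the identification of the Landau copy `(u♮, U₁)` with S3's gauge is the knit's; `LocalLettersSplitTopStepCore(G∕R)`
∕ `DatumGaugeSplitTopStepCore(G∕R)` ∕ `HalvingStepTop(Core)` ∕ `stub_prop8StepCoP13` NOT discharged; K0⁷ ∕ K1⁹ NOT closed; N07 NOT discharged; counts unmoved (typed 28∕28 ·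
discharged 5∕27); one finite 𝕋⁴ programme at fixed ε — the route closes the conditional finite-𝕋⁴ rung `BalabanLadder.UV` ONLY; the YM mass gap (Clay) is NOT proved by any
of this; nothing continuum ∕ ℝ⁴ ∕ OS.  No `sorry`, no `def`, no `instance`, no `notation`.

RELATED IN THE TREE, NOT DUPLICATED: n07-w8 `N07SplitClauseOfShearSize` §3 ∕ `N07SplitClauseOfRecordShear` (the generic-family doors — CONSUMED BY NAME, not restated); FILE 1 `N07SplitClauseBoxesCubeDomains`
(geometry + widths — CONSUMED); n07-e `N07CubeDomainsAdm22` (CONSUMED); dag-n07-w4 g2 `N07LocalLettersHBAtCubeDomains` (the HB summand's door at the same family ∕ window —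
the neighbouring (159)-letter, not this clause).

References: [15] (144) p. 300, (150)–(152) p. 301, (157)–(159) pp. 302–303, (161) p. 303, (164)–(165) p. 304, (168) p. 304; [6] (1.131) p. 99, p. 98; [4] (2.1)–(2.4)
p. 224, (2.35) p. 228, (2.60) p. 234, Cor. 2.8 (2.150)–(2.151) p. 249; [I.4] (1.18)–(1.20) p. 20; [3] (21) p. 21, (85)–(88) p. 31.
-/

set_option autoImplicit false

noncomputable section
open scoped BigOperators Matrix.Norms.L2Operator

namespace Summit.QuantumFields.YangMills.BalabanUVNodes.N07SplitClauseRecordShearAtCubeDomains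

open Literature.MathematicalPhysics.QuantumFieldTheory.Balaban1983to89
open Literature.MathematicalPhysics.QuantumFieldTheory.Balaban1983to89.Node00
open Literature.MathematicalPhysics.QuantumFieldTheory.Balaban1983to89.B12RegularSpaces111 (gaugeU expI grad)
open B15Eq112TorusCover (cover)
open B14DomainGeom (Pt)
open B5Eq118OneStroke (iterBlockOf)
open B8Eq131Cubes (sqLo sqHi box cube)
open B11Eq115Space (levOf)
open B6SectADomainsV1 (Domains)
open B6SectAOperatorsV1 (BondIdx)
open T4Continuum (T4Family)
open T4AxialGaugeSmallField (castSite)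
open B16Sect1Backgrounds (toMS)
open GaugeField (gaugeAct)
open MatrixLog (mlog)
open Summit.QuantumFields.YangMills.Theorems.FlatCubeOpsText (Adm22)
open Summit.QuantumFields.YangMills.Theorems.K0FlatCubeOpsTextP (flatH IsLevWeight)
open Summit.QuantumFields.YangMills.BalabanUVNodes.N07HalvingStepTopOfLocalLetters (Letters10On)
open Summit.QuantumFields.YangMills.BalabanUVNodes.N07LocalLettersSplitCore (LocalGaugeSplitOn)
open Summit.QuantumFields.YangMills.BalabanUVNodes.N07SplitClauseOfRecordShear (localGaugeSplitOn_of_gauge152_recordShear_dominated_adm22_T4)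
open Summit.QuantumFields.YangMills.BalabanUVNodes.N07SplitClauseBoxesCubeDomains (levelBoxes_cubeDomains width_levelBox_le)
open Summit.QuantumFields.YangMills.BalabanUVNodes.N07CubeDomainsAdm22 (adm22_cubeDomains inOm_top_cubeDomains_of_mem_box)

/-- **THE WIDTHS BINDER OF p625131 FROM THE CLOSED-FORM MAJORANT**: for the canonical level boxes of the tower `(a, M, ρ, k)` (`1 ≤ k`) and non-negative letters, the
hypothesis `d·(M + 4ρ + 3)·L^{k−j}·(v_j + a_j) ≤ σ` implies n07-w8's `(Σ_κ (hi_{j,κ} − lo_{j,κ}))·(v_j + a_j) ≤ σ` (FILE 1 `width_levelBox_le`).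
[cite: Balaban1985RegularSpaces, p.98, (1.131) p.99; Balaban1985Variational, (164)–(166) p.304] -/
theorem width_mul_le_of_closedForm {P : Params} {a : Pt P.d} {M ρ k : ℕ} (hk1 : 1 ≤ k) {lo hi : ℕ → Pt P.d}
    (hlo0 : lo 0 = fun i => (P.L : ℤ) * (sqLo P.L a ρ k 1 i - 1))
    (hhi0 : hi 0 = fun i => (P.L : ℤ) * (sqHi P.L a M ρ k 1 i + 1) + ((P.L : ℤ) - 1))
    (hloj : ∀ j, 1 ≤ j → lo j = sqLo P.L a ρ k j - 1) (hhij : ∀ j, 1 ≤ j → hi j = sqHi P.L a M ρ k j + 1)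
    {v av : ℕ → ℝ} {σ : ℝ} (hv0 : ∀ j, 0 ≤ v j) (ha0 : ∀ j, 0 ≤ av j)
    (hDσ : ∀ j ≤ k, ((P.d * ((M + 4 * ρ + 3) * P.L ^ (k - j)) : ℕ) : ℝ) * (v j + av j) ≤ σ) :
    ∀ j ≤ k, ((∑ κ, (hi j κ - lo j κ).toNat : ℕ) : ℝ) * (v j + av j) ≤ σ := by
  intro j hj
  have hw : ((∑ κ, (hi j κ - lo j κ).toNat : ℕ) : ℝ) ≤ ((P.d * ((M + 4 * ρ + 3) * P.L ^ (k - j)) : ℕ) : ℝ) := by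
    exact_mod_cast width_levelBox_le hk1 hlo0 hhi0 hloj hhij hj
  exact (mul_le_mul_of_nonneg_right hw (add_nonneg (hv0 j) (ha0 j))).trans (hDσ j hj)

open scoped Classical in
/-- ★★★ **THE (r2) RECORD DOOR AT THE HEAD's FAMILY AND WINDOW, SIGN-FREE FAMILY** (statement in the header): n07-w8's
`localGaugeSplitOn_of_gauge152_recordShear_dominated_adm22_T4` at `D := cubeDomains (F.P K) a M ρ (K − n)`, `Y := π '' box L a M (K − n)`, canonical weights and CANONICAL
LEVEL BOXES, with `Adm22`, `IsLevWeight`, «window over `Ω_k`», the three box-membership facts and the widths DISCHARGED (39b, FILE 1); the shift family is any `λ` with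
`‖λ_j(y)‖ ≤ ‖log ĝ_j(y)⁻¹‖`; conclusion `LocalGaugeSplitOn (π '' □) η_{K−n} t (t₁ + (t₂ + t_∂) + t₃) U` for every `t_∂ > 2CB₃·(4σ)`.
[cite: Balaban1985Variational, (144) p.300, (150)–(152) p.301, (157)–(159) pp.302–303, (161) p.303, (164)–(165) p.304, (168) p.304; Balaban1985RegularSpaces, (1.131) pp.98–99; Balaban1984PropagatorsII, (2.1)–(2.4) p.224, (2.35) p.228, (2.60) p.234, Cor. 2.8 (2.150)–(2.151) p.249; Balaban1984PropagatorsI, (1.18)–(1.20) p.20; Balaban1985Averaging, (85)–(88) p.31] -/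
theorem localGaugeSplitOn_of_gauge152_recordShear_dominated_cubeDomains_box (F : T4Family) (N : ℕ) [NeZero N] :
    ∃ (Mh₀ R₀ : ℕ) (C δ₀ δ₁ B₃ : ℝ), 0 ≤ C ∧ 0 < δ₀ ∧ 0 < δ₁ ∧ 0 < B₃ ∧
    ∀ (n K : ℕ) (_ : 1 ≤ K - n) (_ : K - n + 1 ≤ F.m + K) (hk : K - n ≤ (F.P K).m + (F.P K).K)
      {Mh R a' : ℕ} (_ : Mh = F.L ^ a') (_ : Mh₀ ≤ Mh) (_ : R₀ ≤ R) (_ : a' + 3 ≤ F.m + n)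
      {a : Pt (F.P K).d} {M ρ : ℕ}
      (_ : F.L * Mh ∣ ρ) (_ : ∀ i, ((F.L * Mh : ℕ) : ℤ) ∣ a i) (_ : F.L * Mh ∣ M) (_ : F.L * Mh ∣ (F.P K).sitesPerDir (K - n)) (_ : R * (F.L * Mh) ≤ ρ)
      (_ : F.L ≤ ρ) (_ : Set.InjOn (cover (F.P K)) (cube (F.P K).L a M ρ (K - n) 0))
      {HV : (BondIdx (cubeDomains (F.P K) a M ρ (K - n) hk) → MatA N) →ₗ[ℂ] (PBond (F.P K) 0 → MatA N)}
      (_ : ∀ (B : BondIdx (cubeDomains (F.P K) a M ρ (K - n) hk) → MatA N) (b : PBond (F.P K) 0),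
        HV B b = ∑ c, ((flatH (F.P K) (K - n) (cubeDomains (F.P K) a M ρ (K - n) hk) (Pi.single c 1) b : ℝ) : ℂ) • B c)
      -- the CANONICAL level boxes of the tower (four equation binders)
      {lo hi : ℕ → Pt (F.P K).d}
      (_ : lo 0 = fun i => ((F.P K).L : ℤ) * (sqLo (F.P K).L a ρ (K - n) 1 i - 1))
      (_ : hi 0 = fun i => ((F.P K).L : ℤ) * (sqHi (F.P K).L a M ρ (K - n) 1 i + 1) + (((F.P K).L : ℤ) - 1))
      (_ : ∀ j, 1 ≤ j → lo j = sqLo (F.P K).L a ρ (K - n) j - 1) (_ : ∀ j, 1 ≤ j → hi j = sqHi (F.P K).L a M ρ (K - n) j + 1)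
      -- the (r1)+(r4) row's Landau copy, its gauge, the per-level bond letters on the canonical boxes, the uniform `σ` against the closed-form widths
      (uL : GaugeTransf (F.P K) 0 (SU N)) (U₁ : GaugeField (F.P K) 0 (SU N)) (v av : ℕ → ℝ) {σ : ℝ}
      (_ : ∀ j, 0 ≤ v j) (_ : ∀ j, 0 ≤ av j) (_ : σ ≤ 1 / 2)
      (_ : ∀ j ≤ K - n, (((F.P K).d * ((M + 4 * ρ + 3) * (F.P K).L ^ ((K - n) - j)) : ℕ) : ℝ) * (v j + av j) ≤ σ)
      (_ : ∀ j ≤ K - n, ∀ c : PBond (F.P K) j, c.src ∈ (castSite '' Set.Icc (lo j) (hi j) : Set (Site (F.P K) j)) →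
        c.tgt ∈ (castSite '' Set.Icc (lo j) (hi j) : Set (Site (F.P K) j)) → dist1 (Averaging.iter (avOfRecord F N K) j (gaugeAct uL U₁) c) ≤ v j)
      (_ : ∀ j ≤ K - n, ∀ c : PBond (F.P K) j, c.src ∈ (castSite '' Set.Icc (lo j) (hi j) : Set (Site (F.P K) j)) →
        c.tgt ∈ (castSite '' Set.Icc (lo j) (hi j) : Set (Site (F.P K) j)) → dist1 (Averaging.iter (avOfRecord F N K) j U₁ c) ≤ av j)
      -- the shift family, DOMINATED by the (r1) letter family, and its datum
      (lam : (j : ℕ) → Site (F.P K) j → MatA N)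
      (_ : ∀ (j : ℕ) (y : Site (F.P K) j), ‖lam j y‖ ≤ ‖mlog (((((toMS uL j (castSite (lo j)))⁻¹ * toMS uL j y)⁻¹ : SU N)) : MatA N)‖)
      {X : BondIdx (cubeDomains (F.P K) a M ρ (K - n) hk) → MatA N}
      (_ : ∀ c : BondIdx (cubeDomains (F.P K) a M ρ (K - n) hk),
        X c = LatticeFieldCalculus.grad (((F.P K).L : ℝ) ^ (K - n) / ((F.P K).L : ℝ) ^ (c.1.1 : ℕ)) (lam c.1.1) c.1.2)
      -- S3's gauge of `U` on the window and the (159)-splitting of `A − H_V X`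
      {U : GaugeField (F.P K) 0 (SU N)} (u : GaugeTransf (F.P K) 0 (SU N)) {A A₁ A₂ A₃ : PBond (F.P K) 0 → MatA N} {t t₁ t₂ t₃ : ℝ}
      (_ : ∀ b ∈ (Sect2.regionOfSet (F.P K) (cover (F.P K) '' box (F.P K).L a M (K - n))).bonds,
        gaugeU (fun x => ιSU N (u x)) (fun b' => ιSU N (U b')) b = expI ((F.P K).eta (K - n)) (A b))
      (_ : ∀ b ∈ (Sect2.regionOfSet (F.P K) (cover (F.P K) '' box (F.P K).L a M (K - n))).bonds, ‖A b‖ < t)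
      (_ : ∀ q ∈ (Sect2.regionOfSet (F.P K) (cover (F.P K) '' box (F.P K).L a M (K - n))).dpairs,
        ‖grad ((F.P K).eta (K - n)) q.2.1 (fun y => A ⟨y, q.2.2⟩) q.1‖ < t)
      (_ : ∀ b, A b - HV X b = A₁ b + A₂ b - A₃ b)
      (_ : Letters10On (cover (F.P K) '' box (F.P K).L a M (K - n)) ((F.P K).eta (K - n)) t₁ A₁)
      (_ : Letters10On (cover (F.P K) '' box (F.P K).L a M (K - n)) ((F.P K).eta (K - n)) t₂ A₂)
      (_ : Letters10On (cover (F.P K) '' box (F.P K).L a M (K - n)) ((F.P K).eta (K - n)) t₃ A₃)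
      {tD : ℝ} (_ : 2 * C * B₃ * (4 * σ) < tD),
      LocalGaugeSplitOn (cover (F.P K) '' box (F.P K).L a M (K - n)) ((F.P K).eta (K - n)) t (t₁ + (t₂ + tD) + t₃) U := by
  obtain ⟨Mh₀, R₀, C, δ₀, δ₁, B₃, hC, hδ₀, hδ₁, hB₃, hmain⟩ := localGaugeSplitOn_of_gauge152_recordShear_dominated_adm22_T4 F N
  refine ⟨Mh₀, R₀, C, δ₀, δ₁, B₃, hC, hδ₀, hδ₁, hB₃, ?_⟩
  intro n K hk1 hk' hk Mh R a' hMha hMh hR hsize a M ρ hρ ha hM hper hRρ hLρ hinj HV hHV lo hi hlo0 hhi0 hloj hhij uL U₁ v av σ hv0 ha0 hσ hDσ hv hav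
    lam hlam X hX U u A A₁ A₂ A₃ t t₁ t₂ t₃ he hA hdA h159 h₁ h₂ h₃ tD htD
  -- `1 ≤ L·M_h`, `(F.P K).L = F.L`
  have hM₁ : 1 ≤ F.L * Mh := by
    rw [hMha]
    exact Nat.one_le_iff_ne_zero.mpr (Nat.mul_ne_zero (by have := F.hL11; omega) (pow_ne_zero _ (by have := F.hL11; omega)))
  have hLP : (F.P K).L = F.L := rfl
  -- the family, its admissibility (39b), the canonical level weights, the window over `Ω_k` (39b)
  have hAdm : Adm22 (cubeDomains (F.P K) a M ρ (K - n) hk) R (F.L * Mh) :=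
    adm22_cubeDomains (P := F.P K) hM₁ hρ (by simpa [hLP] using ha) hM hper hRρ
  have hw : IsLevWeight (F.P K) (K - n) (cubeDomains (F.P K) a M ρ (K - n) hk)
      (fun m b => (((F.P K).L : ℝ) ^ levOf (fun j => {x : Site (F.P K) 0 | (cubeDomains (F.P K) a M ρ (K - n) hk).InOm j x}) (K - n) b.src *
        (((F.P K).L : ℝ)⁻¹) ^ (K - n)) ^ m) := fun _ _ => rfl
  have hY : ∀ x ∈ cover (F.P K) '' box (F.P K).L a M (K - n), (cubeDomains (F.P K) a M ρ (K - n) hk).InOm (K - n) x := by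
    rintro _ ⟨x, hx, rfl⟩
    exact inOm_top_cubeDomains_of_mem_box hinj hk1 hx
  -- the three box-membership facts of the canonical boxes (FILE 1) and the widths binder from its closed form
  obtain ⟨hboxO, hboxS, hbox0⟩ := levelBoxes_cubeDomains (P := F.P K) (a := a) (M := M) (hk := hk) (by simpa [hLP] using hLρ) hlo0 hhi0 hloj hhij
  have hDσ' := width_mul_le_of_closedForm (P := F.P K) hk1 hlo0 hhi0 hloj hhij hv0 ha0 hDσ
  exact hmain n K hk1 hk' hMha hMh hR hsize (cubeDomains (F.P K) a M ρ (K - n) hk) rfl hAdm _ hw hY hHV uL U₁ lo hi v av hv0 ha0 hσ hDσ' hv hav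
    hboxO hboxS hbox0 lam hlam hX u he hA hdA h159 h₁ h₂ h₃ htD

open scoped Classical in
/-- ★★ **THE (r1) ORIENTATION AT THE HEAD's FAMILY AND WINDOW**: the same door for the family `λ_j(y) = −log ĝ_j(y)⁻¹`, whose coarse gradient IS the shift summand of
dag-n07-w6's composed row (r1)+(r4) in potential units (n07-w8's LOCATED-SIGN; `‖−Z‖ = ‖Z‖`). [cite: Balaban1985Variational, (152) p.301, (157)–(159) pp.302–303, (164)–(165) p.304, (168) p.304; Balaban1985Averaging, (85)–(88) p.31; Balaban1984PropagatorsII, (2.1)–(2.4) p.224, Cor. 2.8 (2.150)–(2.151) p.249] -/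
theorem localGaugeSplitOn_of_gauge152_recordShear_neg_cubeDomains_box (F : T4Family) (N : ℕ) [NeZero N] :
    ∃ (Mh₀ R₀ : ℕ) (C δ₀ δ₁ B₃ : ℝ), 0 ≤ C ∧ 0 < δ₀ ∧ 0 < δ₁ ∧ 0 < B₃ ∧
    ∀ (n K : ℕ) (_ : 1 ≤ K - n) (_ : K - n + 1 ≤ F.m + K) (hk : K - n ≤ (F.P K).m + (F.P K).K)
      {Mh R a' : ℕ} (_ : Mh = F.L ^ a') (_ : Mh₀ ≤ Mh) (_ : R₀ ≤ R) (_ : a' + 3 ≤ F.m + n)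
      {a : Pt (F.P K).d} {M ρ : ℕ}
      (_ : F.L * Mh ∣ ρ) (_ : ∀ i, ((F.L * Mh : ℕ) : ℤ) ∣ a i) (_ : F.L * Mh ∣ M) (_ : F.L * Mh ∣ (F.P K).sitesPerDir (K - n)) (_ : R * (F.L * Mh) ≤ ρ)
      (_ : F.L ≤ ρ) (_ : Set.InjOn (cover (F.P K)) (cube (F.P K).L a M ρ (K - n) 0))
      {HV : (BondIdx (cubeDomains (F.P K) a M ρ (K - n) hk) → MatA N) →ₗ[ℂ] (PBond (F.P K) 0 → MatA N)}
      (_ : ∀ (B : BondIdx (cubeDomains (F.P K) a M ρ (K - n) hk) → MatA N) (b : PBond (F.P K) 0),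
        HV B b = ∑ c, ((flatH (F.P K) (K - n) (cubeDomains (F.P K) a M ρ (K - n) hk) (Pi.single c 1) b : ℝ) : ℂ) • B c)
      -- the CANONICAL level boxes of the tower (four equation binders)
      {lo hi : ℕ → Pt (F.P K).d}
      (_ : lo 0 = fun i => ((F.P K).L : ℤ) * (sqLo (F.P K).L a ρ (K - n) 1 i - 1))
      (_ : hi 0 = fun i => ((F.P K).L : ℤ) * (sqHi (F.P K).L a M ρ (K - n) 1 i + 1) + (((F.P K).L : ℤ) - 1))
      (_ : ∀ j, 1 ≤ j → lo j = sqLo (F.P K).L a ρ (K - n) j - 1) (_ : ∀ j, 1 ≤ j → hi j = sqHi (F.P K).L a M ρ (K - n) j + 1)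
      -- the (r1)+(r4) row's Landau copy, its gauge, the per-level bond letters on the canonical boxes, the uniform `σ` against the closed-form widths
      (uL : GaugeTransf (F.P K) 0 (SU N)) (U₁ : GaugeField (F.P K) 0 (SU N)) (v av : ℕ → ℝ) {σ : ℝ}
      (_ : ∀ j, 0 ≤ v j) (_ : ∀ j, 0 ≤ av j) (_ : σ ≤ 1 / 2)
      (_ : ∀ j ≤ K - n, (((F.P K).d * ((M + 4 * ρ + 3) * (F.P K).L ^ ((K - n) - j)) : ℕ) : ℝ) * (v j + av j) ≤ σ)
      (_ : ∀ j ≤ K - n, ∀ c : PBond (F.P K) j, c.src ∈ (castSite '' Set.Icc (lo j) (hi j) : Set (Site (F.P K) j)) →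
        c.tgt ∈ (castSite '' Set.Icc (lo j) (hi j) : Set (Site (F.P K) j)) → dist1 (Averaging.iter (avOfRecord F N K) j (gaugeAct uL U₁) c) ≤ v j)
      (_ : ∀ j ≤ K - n, ∀ c : PBond (F.P K) j, c.src ∈ (castSite '' Set.Icc (lo j) (hi j) : Set (Site (F.P K) j)) →
        c.tgt ∈ (castSite '' Set.Icc (lo j) (hi j) : Set (Site (F.P K) j)) → dist1 (Averaging.iter (avOfRecord F N K) j U₁ c) ≤ av j)
      -- the shift family IN THE (r1) ORIENTATION and its datum
      (lam : (j : ℕ) → Site (F.P K) j → MatA N)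
      (_ : ∀ (j : ℕ) (y : Site (F.P K) j), lam j y = -mlog (((((toMS uL j (castSite (lo j)))⁻¹ * toMS uL j y)⁻¹ : SU N)) : MatA N))
      {X : BondIdx (cubeDomains (F.P K) a M ρ (K - n) hk) → MatA N}
      (_ : ∀ c : BondIdx (cubeDomains (F.P K) a M ρ (K - n) hk),
        X c = LatticeFieldCalculus.grad (((F.P K).L : ℝ) ^ (K - n) / ((F.P K).L : ℝ) ^ (c.1.1 : ℕ)) (lam c.1.1) c.1.2)
      -- S3's gauge of `U` on the window and the (159)-splitting of `A − H_V X`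
      {U : GaugeField (F.P K) 0 (SU N)} (u : GaugeTransf (F.P K) 0 (SU N)) {A A₁ A₂ A₃ : PBond (F.P K) 0 → MatA N} {t t₁ t₂ t₃ : ℝ}
      (_ : ∀ b ∈ (Sect2.regionOfSet (F.P K) (cover (F.P K) '' box (F.P K).L a M (K - n))).bonds,
        gaugeU (fun x => ιSU N (u x)) (fun b' => ιSU N (U b')) b = expI ((F.P K).eta (K - n)) (A b))
      (_ : ∀ b ∈ (Sect2.regionOfSet (F.P K) (cover (F.P K) '' box (F.P K).L a M (K - n))).bonds, ‖A b‖ < t)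
      (_ : ∀ q ∈ (Sect2.regionOfSet (F.P K) (cover (F.P K) '' box (F.P K).L a M (K - n))).dpairs,
        ‖grad ((F.P K).eta (K - n)) q.2.1 (fun y => A ⟨y, q.2.2⟩) q.1‖ < t)
      (_ : ∀ b, A b - HV X b = A₁ b + A₂ b - A₃ b)
      (_ : Letters10On (cover (F.P K) '' box (F.P K).L a M (K - n)) ((F.P K).eta (K - n)) t₁ A₁)
      (_ : Letters10On (cover (F.P K) '' box (F.P K).L a M (K - n)) ((F.P K).eta (K - n)) t₂ A₂)
      (_ : Letters10On (cover (F.P K) '' box (F.P K).L a M (K - n)) ((F.P K).eta (K - n)) t₃ A₃)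
      {tD : ℝ} (_ : 2 * C * B₃ * (4 * σ) < tD),
      LocalGaugeSplitOn (cover (F.P K) '' box (F.P K).L a M (K - n)) ((F.P K).eta (K - n)) t (t₁ + (t₂ + tD) + t₃) U := by
  obtain ⟨Mh₀, R₀, C, δ₀, δ₁, B₃, hC, hδ₀, hδ₁, hB₃, hmain⟩ := localGaugeSplitOn_of_gauge152_recordShear_dominated_cubeDomains_box F N
  refine ⟨Mh₀, R₀, C, δ₀, δ₁, B₃, hC, hδ₀, hδ₁, hB₃, ?_⟩
  intro n K hk1 hk' hk Mh R a' hMha hMh hR hsize a M ρ hρ ha hM hper hRρ hLρ hinj HV hHV lo hi hlo0 hhi0 hloj hhij uL U₁ v av σ hv0 ha0 hσ hDσ hv hav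
    lam hlam X hX U u A A₁ A₂ A₃ t t₁ t₂ t₃ he hA hdA h159 h₁ h₂ h₃ tD htD
  exact hmain n K hk1 hk' hk hMha hMh hR hsize hρ ha hM hper hRρ hLρ hinj hHV hlo0 hhi0 hloj hhij uL U₁ v av hv0 ha0 hσ hDσ hv hav lam
    (fun j y => by rw [hlam j y, norm_neg]) hX u he hA hdA h159 h₁ h₂ h₃ htD

end Summit.QuantumFields.YangMills.BalabanUVNodes.N07SplitClauseRecordShearAtCubeDomains

end
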